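import Summits.Ventures.PercRepro.S1FiveCircuitsSolidBase

/-!
# PercRepro — FOUR-CIRCUITS THROUGH A POINT OF A MATROID OF NULLITY `2` (p1, gen 34)

`proofs/P1-S2-CORANK6.md` §4o. At nullity `2` two distinct circuits exhaust the nullity: every point outside their union
is a coloop (`isColoop_of_notMem_union_of_isCircuit_ne`, from the nullity superadditivity
`eRk_union_add_two_le_encard_of_isCircuit_ne`), so every circuit lies in their union
(`subset_union_of_isCircuit_of_nullity_two`). Hence three four-circuits through a point pairwise meet in three points
(`ncard_inter_eq_three_of_three_fourCircuits`: the third contains the symmetric difference of the first two) and lie in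
a 5-point set of rank `3` (`exists_five_plane_of_three_fourCircuits`). Used by `S1PoorCapTotalThree`. Axioms: standard.
-/

open scoped Matroid

namespace PercRepro

namespace S1

open Set

variable {α : Type}

/-- The intersection of two distinct circuits is a proper subset of each. -/
theorem inter_ssubset_of_isCircuit_ne (N : Matroid α) {C C' : Set α} (hC : N.IsCircuit C) (hC' : N.IsCircuit C')
    (hne : C ≠ C') : C ∩ C' ⊂ C := by
  refine ⟨inter_subset_left, fun h => hne ?_⟩
  exact hC.eq_of_subset_isCircuit hC' (fun x hx => (h hx).2)

/-- **Nullity superadditivity for two distinct circuits**: `r(C ∪ C') + 2 ≤ |C ∪ C'|`. -/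
theorem eRk_union_add_two_le_encard_of_isCircuit_ne (N : Matroid α) [N.Finite] {C C' : Set α}
    (hC : N.IsCircuit C) (hC' : N.IsCircuit C') (hne : C ≠ C') :
    N.eRk (C ∪ C') + ((2 : ℕ) : ℕ∞) ≤ (C ∪ C').encard := by
  have h1 : C.encard = N.eRk C + ((1 : ℕ) : ℕ∞) := by rw [← hC.eRk_add_one_eq]; rfl
  have h2 : C'.encard = N.eRk C' + ((1 : ℕ) : ℕ∞) := by rw [← hC'.eRk_add_one_eq]; rfl
  have h3 : (C ∩ C').encard ≤ N.eRk (C ∩ C') + ((0 : ℕ) : ℕ∞) := by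
    rw [(hC.ssubset_indep (inter_ssubset_of_isCircuit_ne N hC hC' hne)).eRk_eq_encard]
    simp
  have := eRk_union_add_add_le_encard_add_of_nullity N hC.subset_ground hC'.subset_ground h1 h2 h3
  simp only [Nat.cast_zero, add_zero, Nat.cast_one] at this
  rw [add_assoc, one_add_one_eq_two] at this
  simpa using this

/-- **At nullity `2`, a point outside the union of two distinct circuits is a coloop.** -/
theorem isColoop_of_notMem_union_of_isCircuit_ne (N : Matroid α) [N.Finite] (hd : N.E.encard = N.eRank + 2)
    {C C' : Set α} (hC : N.IsCircuit C) (hC' : N.IsCircuit C') (hne : C ≠ C') {x : α} (hx : x ∈ N.E)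
    (hxU : x ∉ C ∪ C') : N.IsColoop x :=
  isColoop_of_notMem_of_nullity_eq N (union_subset hC.subset_ground hC'.subset_ground)
    (eRk_union_add_two_le_encard_of_isCircuit_ne N hC hC' hne) (by rw [hd]; rfl) hx hxU

/-- **At nullity `2`, every circuit lies in the union of two distinct circuits.** -/
theorem subset_union_of_isCircuit_of_nullity_two (N : Matroid α) [N.Finite] (hd : N.E.encard = N.eRank + 2)
    {C C' : Set α} (hC : N.IsCircuit C) (hC' : N.IsCircuit C') (hne : C ≠ C') {D : Set α} (hD : N.IsCircuit D) :
    D ⊆ C ∪ C' := by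
  intro x hxD
  by_contra hxU
  exact (isColoop_of_notMem_union_of_isCircuit_ne N hd hC hC' hne (hD.subset_ground hxD) hxU).notMem_isCircuit hD hxD

/-- **Three four-circuits through a point at nullity `2` pairwise meet in three points**: the third lies in the
union of the first two and contains their symmetric difference, which must then have `≤ 3` points. -/
theorem ncard_inter_eq_three_of_three_fourCircuits (N : Matroid α) [N.Finite] (hd : N.E.encard = N.eRank + 2)
    {D₁ D₂ D₃ : Set α} (h₁ : N.IsCircuit D₁) (h₁4 : D₁.ncard = 4) (h₂ : N.IsCircuit D₂) (h₂4 : D₂.ncard = 4)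
    (h₃ : N.IsCircuit D₃) (h₃4 : D₃.ncard = 4) (h12 : D₁ ≠ D₂) (h13 : D₁ ≠ D₃) (h23 : D₂ ≠ D₃)
    {y : α} (hy₁ : y ∈ D₁) (hy₂ : y ∈ D₂) (hy₃ : y ∈ D₃) : (D₁ ∩ D₂).ncard = 3 := by
  have hD₂ : D₂ ⊆ D₁ ∪ D₃ := subset_union_of_isCircuit_of_nullity_two N hd h₁ h₃ h13 h₂
  have hD₁ : D₁ ⊆ D₂ ∪ D₃ := subset_union_of_isCircuit_of_nullity_two N hd h₂ h₃ h23 h₁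
  have hsym : (D₁ \ D₂) ∪ (D₂ \ D₁) ⊆ D₃ := by
    rintro z (⟨hz1, hz2⟩ | ⟨hz2, hz1⟩)
    · rcases hD₁ hz1 with h | h
      · exact absurd h hz2
      · exact h
    · rcases hD₂ hz2 with h | h
      · exact absurd h hz1
      · exact h
  have hfin₁ : D₁.Finite := finite_of_ncard_pos (by omega)
  have hfin₂ : D₂.Finite := finite_of_ncard_pos (by omega)
  have hfin₃ : D₃.Finite := finite_of_ncard_pos (by omega)
  have hyS : y ∉ (D₁ \ D₂) ∪ (D₂ \ D₁) := by simp [hy₁, hy₂]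
  have hsub' : insert y ((D₁ \ D₂) ∪ (D₂ \ D₁)) ⊆ D₃ := insert_subset hy₃ hsym
  have h1 := ncard_le_ncard hsub' hfin₃
  rw [ncard_insert_of_notMem hyS ((hfin₁.sdiff).union (hfin₂.sdiff)),
    ncard_union_eq disjoint_sdiff_sdiff hfin₁.sdiff hfin₂.sdiff] at h1
  have e1 := ncard_inter_add_ncard_sdiff_eq_ncard D₁ D₂ hfin₁
  have e2 := ncard_inter_add_ncard_sdiff_eq_ncard D₂ D₁ hfin₂
  rw [inter_comm] at e2
  have hlt : (D₁ ∩ D₂).ncard < 4 := by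
    by_contra hge
    push Not at hge
    have heq : D₁ ∩ D₂ = D₁ := eq_of_subset_of_ncard_le inter_subset_left (by omega) hfin₁
    exact h12 (h₁.eq_of_subset_isCircuit h₂ (fun x hx => ((Set.ext_iff.1 heq x).2 hx).2))
  omega

/-- **Three four-circuits through a point at nullity `2` lie in a 5-point plane**: the union of two of them, of
rank `3` (nullity superadditivity: `r + 2 ≤ 5`). -/
theorem exists_five_plane_of_three_fourCircuits (N : Matroid α) [N.Finite] (hd : N.E.encard = N.eRank + 2)
    {D₁ D₂ D₃ : Set α} (h₁ : N.IsCircuit D₁) (h₁4 : D₁.ncard = 4) (h₂ : N.IsCircuit D₂) (h₂4 : D₂.ncard = 4)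
    (h₃ : N.IsCircuit D₃) (h₃4 : D₃.ncard = 4) (h12 : D₁ ≠ D₂) (h13 : D₁ ≠ D₃) (h23 : D₂ ≠ D₃)
    {y : α} (hy₁ : y ∈ D₁) (hy₂ : y ∈ D₂) (hy₃ : y ∈ D₃) :
    ∃ Q ⊆ N.E, Q.ncard = 5 ∧ N.eRk Q = 3 := by
  have hfin₁ : D₁.Finite := finite_of_ncard_pos (by omega)
  have hfin₂ : D₂.Finite := finite_of_ncard_pos (by omega)
  have h3 := ncard_inter_eq_three_of_three_fourCircuits N hd h₁ h₁4 h₂ h₂4 h₃ h₃4 h12 h13 h23 hy₁ hy₂ hy₃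
  have hU : (D₁ ∪ D₂).ncard = 5 := by
    have := ncard_union_add_ncard_inter D₁ D₂ hfin₁ hfin₂
    omega
  refine ⟨D₁ ∪ D₂, union_subset h₁.subset_ground h₂.subset_ground, hU, ?_⟩
  have hUfin : (D₁ ∪ D₂).Finite := hfin₁.union hfin₂
  have hle := eRk_union_add_two_le_encard_of_isCircuit_ne N h₁ h₂ h12
  rw [← hUfin.cast_ncard_eq, hU] at hle
  obtain ⟨r, hr⟩ := exists_eRk_eq_coe N (D₁ ∪ D₂)
  rw [hr] at hle ⊢
  have hr5 : r + 2 ≤ 5 := by exact_mod_cast hle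
  have hge : N.eRk D₁ ≤ N.eRk (D₁ ∪ D₂) := N.eRk_mono subset_union_left
  have hr1 : N.eRk D₁ = 3 := by
    have h := h₁.eRk_add_one_eq
    rw [← hfin₁.cast_ncard_eq, h₁4] at h
    obtain ⟨s, hs⟩ := exists_eRk_eq_coe N D₁
    rw [hs] at h ⊢
    have : s + 1 = 4 := by exact_mod_cast h
    have : s = 3 := by omega
    rw [this]; rfl
  rw [hr1, hr] at hge
  have hr3 : 3 ≤ r := by exact_mod_cast hge
  have : r = 3 := by omega
  rw [this]; rfl

end S1

end PercRepro
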